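import Summits.NavierStokesRegularity.NavierStokesRegularity.Theorems.SoloRefuteLiuYong2026Step4Bounded
import Summits.NavierStokesRegularity.NavierStokesRegularity.Theorems.SoloRefuteLiuYong2026K41Arith
import HarnessLib

/-!
# C138 `LiuYong2026` — Step 4 (引理H.1) is false at its LITERAL two-sided grain:
# `not_Step4_H1 : ¬ Literature.Claims.NS.LiuYong2026.Step4_H1` (part 2/2)

`Step4_H1` (命题4.4 proof p.18 L24–p.19 L4 resting on 附录H 引理H.1 p.57 L8–L17, with the K41 law typed as
PRINTED, two-sided and per lattice mode: `IsK41 Φ` ⇔ `Φ(k)|k|^{5/3} → C > 0` cofinitely on `ℤ³`) asserts: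
a global Leray–Hopf solution of the forced chain whose Cesàro spectrum obeys the K41 law (and is infrared
bounded) has uniform-in-time `H^s` bounds of every order. The kernel so far negates only the sibling
`Step4_H1_upper` (weaker hypothesis `IsK41Upper`; `step4_of_upper : Step4_H1_upper → Step4_H1` goes the other
way), by witnesses with Cesàro spectrum `Φ ≡ 0`. Here the hypotheses are met NON-VACUOUSLY:

**Witness (ν = 1), on the slot engine `…Theorems.LiuYong2026.Slot`.** Enumerate `ℤ³ ∖ 0` up to sign
(`K41Slot.modeAt`, active indices `rep j = j`, part 1). Slot `[n, n+1)` carries the exact shear-mode solution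
`h_j ψ(t−n) Re(pol(k_j) e^{2πi k_j·x})`, `j = v₂(n+1)`, `k_j = modeAt j`, with `pol(k) ⊥ k` and heights
`h_j² = 2^{j+1}·8·|k_j|^{−5/3} / (‖pol k_j‖² I₂)` on active `j` (`I₂ = ∫₀¹ψ²`), `h_j = 0` otherwise. Datum `0`,
force jointly smooth, exact classical ⇒ `IsData` and `IsGlobalLerayHopf` (engine). Per slot
`∫ₙ^{n+1} E_{±k_j}(u) = h_j²‖pol‖² I₂/8 = 2^{j+1}|k_j|^{−5/3}`; index `j` recurs with density `2^{−(j+1)}`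
(`|#{n<N : v₂(n+1)=j} − N/2^{j+1}| ≤ 1`), whence `|∫₀ᵀ E_k(u) − T|k|^{−5/3}| ≤ 3·2^{j+1}|k|^{−5/3}` and the
Cesàro limits exist and equal **`Φ(k) = |k|^{−5/3}` for every `k ≠ 0`** — the Kolmogorov law EXACTLY
(`IsK41` with `C = 1`, `InfraredBounded` with `B = 1`). At the centre of the slot `2^j − 1` (active `j`)
`(1+|k_j|²)‖û(k_j)‖² · I₂ = (1+|k_j|²)|k_j|^{−5/3} 2^{j+2} ≥ 2^{j+2}`, unbounded ⇒ ¬`UniformSobolevBounds`.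

Remark: `Σ_{k∈ℤ³∖0}|k|^{−5/3} = +∞`, so `IsK41 Φ ∧ HasCesaroSpectrum u Φ` forces `sup_t ℰ(u(t)) = +∞`; every
witness against the two-sided `Step4_H1` lives in the TYPED class with unbounded kinetic energy (as
`not_Step4_H1_upper`, p514351); the USED one-sided grain is decided inside the bounded-energy class by
`not_Step4_H1_upper_bdd`.

first failing step = `Literature.Claims.NS.LiuYong2026.Step4_H1` is NOT claimed: the adjudicated token of row
#119 is `Step3_K41` / `not_Step3_K41` (p511629); this is a downstream-column companion (refuter-6 g3,
ns-claims D-0090). WHAT THIS IS NOT: not a claim about NS regularity or blow-up; not a claim about any author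
beyond the typed locator.
-/

set_option linter.dupNamespace false
set_option autoImplicit false

noncomputable section

open Set MeasureTheory Filter Topology intervalIntegral Finset
open scoped ContDiff

open Literature.Claims.NS.LiuYong2026 Literature.Analysis Literature.Analysis.FluidPDE
  Literature.Analysis.FunctionSpaces Literature.Analysis.FunctionSpaces.Torus

namespace Summit.NavierStokesRegularity.NavierStokesRegularity.Theorems.LiuYong2026

namespace K41Slot

open Slot

/-! ## The bump mass `I₂ = ∫₀¹ ψ²` -/
/-- `I₂ = ∫₀¹ ψ(s)² ds`. -/
def I2 : ℝ := ∫ s in (0 : ℝ)..1, bumpFn s ^ 2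

/-- `s ↦ ψ(s)²` is continuous. -/
theorem continuous_bumpFn_sq : Continuous fun s => bumpFn s ^ 2 := contDiff_bumpFn.continuous.pow 2

/-- `ψ = 1` on `[3/8, 5/8]`. -/
theorem bumpFn_eq_one {s : ℝ} (hs : s ∈ Icc (3 / 8 : ℝ) (5 / 8)) : bumpFn s = 1 := by
  show (bump : ℝ → ℝ) s = 1
  apply bump.one_of_mem_closedBall
  rw [Metric.mem_closedBall, Real.dist_eq, show bump.rIn = 1 / 8 from rfl, abs_le]
  constructor <;> linarith [hs.1, hs.2]

/-- `1/4 ≤ I₂`. -/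
theorem I2_ge : 1 / 4 ≤ I2 := by
  have hi : ∀ a b : ℝ, IntervalIntegrable (fun s => bumpFn s ^ 2) volume a b :=
    fun a b => continuous_bumpFn_sq.intervalIntegrable a b
  have hsplit : I2 = (∫ s in (0 : ℝ)..3 / 8, bumpFn s ^ 2) + ((∫ s in (3 / 8 : ℝ)..5 / 8, bumpFn s ^ 2)
      + ∫ s in (5 / 8 : ℝ)..1, bumpFn s ^ 2) := by
    unfold I2
    rw [integral_add_adjacent_intervals (hi _ _) (hi _ _),
      integral_add_adjacent_intervals (hi _ _) (hi _ _)]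
  have hmid : ∫ s in (3 / 8 : ℝ)..5 / 8, bumpFn s ^ 2 = 1 / 4 := by
    rw [integral_congr (g := fun _ => (1 : ℝ)) ?_]
    · rw [intervalIntegral.integral_const]; norm_num
    · intro s hs
      rw [Set.uIcc_of_le (by norm_num)] at hs
      simp [bumpFn_eq_one hs]
  have h1 : 0 ≤ ∫ s in (0 : ℝ)..3 / 8, bumpFn s ^ 2 :=
    intervalIntegral.integral_nonneg (by norm_num) fun s _ => sq_nonneg _
  have h3 : 0 ≤ ∫ s in (5 / 8 : ℝ)..1, bumpFn s ^ 2 :=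
    intervalIntegral.integral_nonneg (by norm_num) fun s _ => sq_nonneg _
  rw [hsplit, hmid]
  linarith

/-- `0 < I₂`. -/
theorem I2_pos : 0 < I2 := lt_of_lt_of_le (by norm_num) I2_ge

/-! ## Heights, slot data, the flow -/
/-- Heights: `h_j = √(2^{j+1}·8·|k_j|^{−5/3}/(‖pol k_j‖² I₂))` on active `j`, `0` otherwise. -/
def amp (j : ℕ) : ℝ :=
  if rep j = j then Real.sqrt (2 ^ (j + 1) * 8 * klen (modeAt j) ^ (-(5 / 3 : ℝ)) /
    (‖pol (modeAt j)‖ ^ 2 * I2)) else 0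

/-- Inactive indices carry no energy. -/
theorem amp_of_not_active {j : ℕ} (hj : rep j ≠ j) : amp j = 0 := if_neg hj

/-- The designed identity `h_j² ‖pol k_j‖² I₂ / 8 = 2^{j+1}|k_j|^{−5/3}` on active `j`. -/
theorem amp_sq_mul {j : ℕ} (hj : rep j = j) :
    amp j ^ 2 * ‖pol (modeAt j)‖ ^ 2 / 8 * I2 = 2 ^ (j + 1) * klen (modeAt j) ^ (-(5 / 3 : ℝ)) := by
  have hp : 0 < ‖pol (modeAt j)‖ ^ 2 := pow_pos (norm_pol_pos _) 2
  have hr : 0 ≤ klen (modeAt j) ^ (-(5 / 3 : ℝ)) :=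
    Real.rpow_nonneg (klen_pos (modeAt_ne_zero j)).le _
  have hI := I2_pos
  rw [amp, if_pos hj, Real.sq_sqrt (by positivity)]
  have hne : ‖pol (modeAt j)‖ ^ 2 * I2 ≠ 0 := by positivity
  have e := div_mul_cancel₀ (2 ^ (j + 1) * 8 * klen (modeAt j) ^ (-(5 / 3 : ℝ))) hne
  linear_combination (1 / 8 : ℝ) * e

/-- Wave vector of slot `n`. -/
def hK (n : ℕ) : Z3 := modeAt (sched n)

/-- Polarisation of slot `n`. -/
def hc (n : ℕ) : C3 := pol (modeAt (sched n))

/-- Height of slot `n`. -/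
def hh (n : ℕ) : ℝ := amp (sched n)

/-- Each slot mode is divergence-free. -/
theorem hK_div (n : ℕ) : ∑ j, ((hK n j : ℂ)) * hc n j = 0 := pol_divFree _

/-- No slot wave vector is its own negative. -/
theorem hK_ne_neg (n : ℕ) : hK n ≠ -hK n := modeAt_ne_neg _

/-- **The exact-K41 slot flow** (ν = 1). -/
def k41Vel : ℝ → T3 → E3 := slotVel hh hK hc

/-- Its force. -/
def k41Frc : ℝ → T3 → E3 := slotFrc 1 hh hK hc

/-- Smooth data of Theorem 1 (`ν = 1`, force jointly smooth and divergence-free, datum `0`). -/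
theorem isData_k41 : IsData 1 k41Frc (k41Vel 0) := isData_slotVel 1 hh hK hc one_pos hK_div

/-- A global Leray–Hopf solution from its datum (it is an exact classical solution). -/
theorem isGlobalLerayHopf_k41 : Torus.IsGlobalLerayHopf 1 k41Frc (k41Vel 0) k41Vel :=
  isGlobalLerayHopf_slotVel 1 hh hK hc hK_div

/-! ## Mode energies of one slot -/
/-- `E_k(w_n) = ‖c_n‖²/8` for `k = ±K n`. -/
theorem modeEnergy_slotMode_of_sameClass {n : ℕ} {k : Z3} (hk : SameClass k (hK n)) :
    modeEnergy (slotMode hK hc n) k = ‖hc n‖ ^ 2 / 8 := by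
  have hne : hK n ≠ -hK n := hK_ne_neg n
  have hcoeff : ‖coeff (slotMode hK hc n) k‖ = ‖hc n‖ / 2 := by
    rcases hk with hk | hk
    · rw [hk, coeff_slotMode_self hK hc hne, norm_smul, norm_inv, Complex.norm_ofNat]
      ring
    · rw [hk]
      unfold coeff slotMode
      have hne' : -hK n ≠ hK n := fun h => hne h.symm
      rw [mFourierCoeff_realTrigPoly_singleton, if_neg hne', if_pos rfl, zero_add, norm_smul, norm_inv,
        Complex.norm_ofNat, EuclideanSpace.norm_conjVec]
      ring
  unfold modeEnergy
  rw [hcoeff]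
  ring

/-- Per-slot constant `q_n(k) = h_n² E_k(w_n) I₂`. -/
def term (k : Z3) (n : ℕ) : ℝ := hh n ^ 2 * modeEnergy (slotMode hK hc n) k * I2

/-- `0 ≤ q_n(k)`. -/
theorem term_nonneg (k : Z3) (n : ℕ) : 0 ≤ term k n :=
  mul_nonneg (mul_nonneg (sq_nonneg _) (LiuYong2026Salvage.modeEnergy_nonneg _ _)) I2_pos.le

/-- For `k` in the class of the active index `j`: `q_n(k) = [v₂(n+1) = j] · 2^{j+1}|k|^{−5/3}`. -/
theorem term_eq {k : Z3} {j : ℕ} (hj : rep j = j) (hjk : SameClass (modeAt j) k) (n : ℕ) :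
    term k n = if sched n = j then 2 ^ (j + 1) * klen k ^ (-(5 / 3 : ℝ)) else 0 := by
  unfold term
  split_ifs with hs
  · have hk : SameClass k (hK n) := by rw [hK, hs]; exact hjk.symm
    rw [modeEnergy_slotMode_of_sameClass hk, hh, hc, hs, ← klen_of_sameClass hjk, ← amp_sq_mul hj]
    ring
  · by_cases hcl : SameClass k (hK n)
    · have hr : rep (sched n) = j := by
        rw [← hj]
        exact rep_eq_of_sameClass (hcl.symm.trans hjk.symm)
      have hna : rep (sched n) ≠ sched n := fun h => hs (h.symm.trans hr)
      rw [hh, amp_of_not_active hna]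
      ring
    · have h1 : k ≠ hK n := fun h => hcl (Or.inl h)
      have h2 : k ≠ -hK n := fun h => hcl (Or.inr h)
      rw [modeEnergy_slotMode_eq_zero hK hc h1 h2]
      ring

/-! ## Per-slot integrals of the mode energies -/
/-- The integrand `t ↦ E_k(u(t))`. -/
def F (k : Z3) (t : ℝ) : ℝ := modeEnergy (k41Vel t) k

/-- `0 ≤ E_k(u(t))`. -/
theorem F_nonneg (k : Z3) (t : ℝ) : 0 ≤ F k t := LiuYong2026Salvage.modeEnergy_nonneg _ _

/-- On the slot `[n, n+1]` the integrand is `(h_n ψ(t−n))² E_k(w_n)` (both sides vanish at `t = n+1`). -/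
theorem F_eqOn (k : Z3) (n : ℕ) :
    EqOn (F k) (fun t => (hh n * bumpFn (t - n)) ^ 2 * modeEnergy (slotMode hK hc n) k)
      (Icc (n : ℝ) (n + 1)) := by
  intro t ht
  have ht0 : 0 ≤ t := (Nat.cast_nonneg n).trans ht.1
  simp only [F, k41Vel]
  rw [modeEnergy_slotVel]
  rcases eq_or_lt_of_le ht.2 with h | h
  · have hfl : ⌊t⌋₊ = n + 1 :=
      (Nat.floor_eq_iff ht0).2 ⟨by push_cast; linarith, by push_cast; linarith⟩
    rw [hfl, slotAmp, h, Nat.cast_succ, sub_self, add_sub_cancel_left,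
      bumpFn_eq_zero (Or.inl (by norm_num)), bumpFn_eq_zero (Or.inr (by norm_num))]
    simp
  · have hfl : ⌊t⌋₊ = n := (Nat.floor_eq_iff ht0).2 ⟨ht.1, h⟩
    rw [hfl, slotAmp]

/-- The slot profile is continuous in `t`. -/
theorem continuous_slotFun (k : Z3) (n : ℕ) :
    Continuous fun t : ℝ => (hh n * bumpFn (t - n)) ^ 2 * modeEnergy (slotMode hK hc n) k :=
  ((continuous_const.mul (contDiff_bumpFn.continuous.comp (continuous_id.sub continuous_const))).pow
    2).mul continuous_const

/-- `E_k(u(·))` is integrable on every sub-interval of a slot. -/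
theorem intervalIntegrable_F_slot (k : Z3) (n : ℕ) {a b : ℝ} (ha : (n : ℝ) ≤ a) (hab : a ≤ b)
    (hb : b ≤ n + 1) : IntervalIntegrable (F k) volume a b := by
  refine ContinuousOn.intervalIntegrable ?_
  rw [Set.uIcc_of_le hab]
  exact (continuous_slotFun k n).continuousOn.congr ((F_eqOn k n).mono (Icc_subset_Icc ha hb))

/-- **Per-slot integral**: `∫ₙ^{n+1} E_k(u) = q_n(k)`. -/
theorem integral_F_slot (k : Z3) (n : ℕ) : ∫ t in (n : ℝ)..(n + 1), F k t = term k n := by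
  rw [integral_congr fun t ht => F_eqOn k n (by rwa [Set.uIcc_of_le (by linarith)] at ht)]
  have e : (fun t : ℝ => (hh n * bumpFn (t - n)) ^ 2 * modeEnergy (slotMode hK hc n) k) =
      fun t => (hh n ^ 2 * modeEnergy (slotMode hK hc n) k) * (fun s => bumpFn s ^ 2) (t - n) := by
    funext t
    ring
  rw [e, intervalIntegral.integral_const_mul,
    intervalIntegral.integral_comp_sub_right (fun s => bumpFn s ^ 2)]
  simp only [sub_self, add_sub_cancel_left]
  unfold term I2
  ring

/-- `E_k(u(·))` is integrable on `[0, N]`. -/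
theorem intervalIntegrable_F_upto (k : Z3) : ∀ N : ℕ, IntervalIntegrable (F k) volume 0 N
  | 0 => by simp
  | N + 1 => (intervalIntegrable_F_upto k N).trans (by
      have := intervalIntegrable_F_slot k N le_rfl (by linarith) le_rfl
      push_cast
      exact this)

/-- `∫₀ᴺ E_k(u) = Σ_{n<N} q_n(k)`. -/
theorem integral_F_nat (k : Z3) (N : ℕ) : ∫ t in (0 : ℝ)..N, F k t = ∑ n ∈ range N, term k n := by
  have h := intervalIntegral.sum_integral_adjacent_intervals (a := fun n : ℕ => (n : ℝ)) (μ := volume)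
    (f := F k) (n := N) (fun n _ => by
      have := intervalIntegrable_F_slot k n le_rfl (by linarith) le_rfl
      push_cast
      exact this)
  simp only [Nat.cast_zero] at h
  rw [← h]
  refine Finset.sum_congr rfl fun n _ => ?_
  rw [Nat.cast_succ, integral_F_slot]

/-- `Σ_{n<N} q_n(k) = #{n<N : v₂(n+1) = j} · 2^{j+1}|k|^{−5/3}` for `k` in the class of the active `j`. -/
theorem sum_term_eq {k : Z3} {j : ℕ} (hj : rep j = j) (hjk : SameClass (modeAt j) k) (N : ℕ) :
    ∑ n ∈ range N, term k n = cnt j N * (2 ^ (j + 1) * klen k ^ (-(5 / 3 : ℝ))) := by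
  simp_rw [term_eq hj hjk]
  rw [Finset.sum_ite, Finset.sum_const_zero, add_zero, Finset.sum_const, nsmul_eq_mul]
  rfl

/-- **Linear growth with bounded defect**: `|∫₀ᵀ E_k(u) − |k|^{−5/3} T| ≤ 3·2^{j+1}|k|^{−5/3}`, `T ≥ 1`. -/
theorem abs_integral_sub_le {k : Z3} (hk : k ≠ 0) :
    ∃ B : ℝ, ∀ T : ℝ, 1 ≤ T → |(∫ t in (0 : ℝ)..T, modeEnergy (k41Vel t) k) - PhiK k * T| ≤ B := by
  obtain ⟨j, hj, hjk⟩ := exists_active hk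
  set q : ℝ := 2 ^ (j + 1) * klen k ^ (-(5 / 3 : ℝ)) with hq
  have hq0 : 0 ≤ q := mul_nonneg (by positivity) (Real.rpow_nonneg (klen_pos hk).le _)
  refine ⟨3 * q, fun T hT => ?_⟩
  have hT0 : 0 ≤ T := by linarith
  set N : ℕ := ⌊T⌋₊ with hNdef
  have hN : (N : ℝ) ≤ T := Nat.floor_le hT0
  have hN1 : T < N + 1 := Nat.lt_floor_add_one T
  have hINT : IntervalIntegrable (F k) volume N T := intervalIntegrable_F_slot k N le_rfl hN hN1.le
  have hsplit : (∫ t in (0 : ℝ)..T, F k t) = (∫ t in (0 : ℝ)..N, F k t) + ∫ t in (N : ℝ)..T, F k t :=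
    (integral_add_adjacent_intervals (intervalIntegrable_F_upto k N) hINT).symm
  have htail0 : 0 ≤ ∫ t in (N : ℝ)..T, F k t :=
    intervalIntegral.integral_nonneg hN fun t _ => F_nonneg k t
  have htail1 : (∫ t in (N : ℝ)..T, F k t) ≤ q := by
    calc (∫ t in (N : ℝ)..T, F k t) ≤ ∫ t in (N : ℝ)..(N + 1), F k t :=
          intervalIntegral.integral_mono_interval le_rfl hN hN1.le
            (Eventually.of_forall fun t => F_nonneg k t)
            (intervalIntegrable_F_slot k N le_rfl (by linarith) le_rfl)
      _ = term k N := integral_F_slot k N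
      _ ≤ q := by rw [term_eq hj hjk]; split_ifs <;> linarith
  have hcnt := abs_le.1 (abs_cnt_sub_le j N)
  have hPhi : PhiK k = q / 2 ^ (j + 1) := by
    rw [PhiK_of_ne hk, hq]
    field_simp
  have hP : (1 : ℝ) ≤ 2 ^ (j + 1) := one_le_pow₀ (by norm_num)
  have hP0 : (0 : ℝ) < 2 ^ (j + 1) := by positivity
  show |(∫ t in (0 : ℝ)..T, F k t) - PhiK k * T| ≤ 3 * q
  rw [hsplit, integral_F_nat, sum_term_eq hj hjk, hPhi]
  have e : (cnt j N : ℝ) * q + (∫ t in (N : ℝ)..T, F k t) - q / 2 ^ (j + 1) * T =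
      q * ((cnt j N : ℝ) - N / 2 ^ (j + 1)) + (∫ t in (N : ℝ)..T, F k t) - q * ((T - N) / 2 ^ (j + 1)) := by
    field_simp
    ring
  have hd1 : q * ((cnt j N : ℝ) - N / 2 ^ (j + 1)) ≤ q * 1 := mul_le_mul_of_nonneg_left hcnt.2 hq0
  have hd2 : q * (-1) ≤ q * ((cnt j N : ℝ) - N / 2 ^ (j + 1)) := mul_le_mul_of_nonneg_left hcnt.1 hq0
  have hτ0 : 0 ≤ (T - N) / 2 ^ (j + 1) := div_nonneg (by linarith) hP0.le
  have hτ1 : (T - N) / 2 ^ (j + 1) ≤ 1 := (div_le_self (by linarith) hP).trans (by linarith)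
  have hd3 : q * ((T - N) / 2 ^ (j + 1)) ≤ q * 1 := mul_le_mul_of_nonneg_left hτ1 hq0
  have hd4 : 0 ≤ q * ((T - N) / 2 ^ (j + 1)) := mul_nonneg hq0 hτ0
  rw [e, abs_le]
  constructor <;> linarith

/-- **Exact Kolmogorov Cesàro spectrum**: `T⁻¹∫₀ᵀ E_k(u) → |k|^{−5/3}` for every `k ≠ 0`. -/
theorem hasCesaroSpectrum_k41 : HasCesaroSpectrum k41Vel PhiK := by
  intro k hk
  obtain ⟨B, hB⟩ := abs_integral_sub_le hk
  exact tendsto_cesaro_of_linear hB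

/-! ## No uniform `H¹` bound -/
/-- `(1 + |k|²)|k|^{−5/3} ≥ 1` for `k ≠ 0`. -/
theorem one_le_weight_mul_rpow {k : Z3} (hk : k ≠ 0) :
    1 ≤ (1 + freqNormSq k) * klen k ^ (-(5 / 3 : ℝ)) := by
  have h1 : 1 ≤ klen k := one_le_klen hk
  have h0 : 0 < klen k := klen_pos hk
  have hsq : freqNormSq k = klen k ^ 2 := by
    unfold klen
    rw [Real.sq_sqrt (le_trans zero_le_one (one_le_freqNormSq hk))]
  have hmono : klen k ^ (-(2 : ℝ)) ≤ klen k ^ (-(5 / 3 : ℝ)) :=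
    Real.rpow_le_rpow_of_exponent_le h1 (by norm_num)
  have htwo : klen k ^ (-(2 : ℝ)) = (klen k ^ 2)⁻¹ := by
    rw [Real.rpow_neg h0.le, Real.rpow_two]
  have hk2 : 0 < klen k ^ 2 := by positivity
  calc (1 : ℝ) ≤ (1 + klen k ^ 2) * (klen k ^ 2)⁻¹ := by
        rw [← div_eq_mul_inv, le_div_iff₀ hk2]; linarith
    _ ≤ (1 + klen k ^ 2) * klen k ^ (-(5 / 3 : ℝ)) := by
        rw [← htwo]; exact mul_le_mul_of_nonneg_left hmono (by positivity)
    _ = (1 + freqNormSq k) * klen k ^ (-(5 / 3 : ℝ)) := by rw [hsq]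

/-- **The exact-K41 slot flow has no uniform `H¹` bound**: at the centre of slot `2^j − 1` (active `j`)
`(1 + |k_j|²)‖û(k_j)‖² ≥ 2^{j+2}/I₂`. -/
theorem not_uniformSobolevBounds_k41 : ¬ UniformSobolevBounds k41Vel := fun hU => by
  obtain ⟨C, hC⟩ := sobolev_one_lower hh hK hc hK_ne_neg hU
  obtain ⟨j₀, hj₀⟩ := pow_unbounded_of_one_lt (C * I2) (by norm_num : (1 : ℝ) < 2)
  obtain ⟨j, hjge, hj⟩ := exists_active_ge j₀
  have h := hC (2 ^ j - 1)
  have hs : sched (2 ^ j - 1) = j := sched_two_pow_sub_one j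
  simp only [hK, hc, hh, hs] at h
  have hsq : (|amp j| * ‖pol (modeAt j)‖ / 2) ^ 2 = 2 * (amp j ^ 2 * ‖pol (modeAt j)‖ ^ 2 / 8) := by
    rw [div_pow, mul_pow, sq_abs]
    ring
  have key : (1 + freqNormSq (modeAt j)) * (|amp j| * ‖pol (modeAt j)‖ / 2) ^ 2 * I2 =
      (1 + freqNormSq (modeAt j)) * klen (modeAt j) ^ (-(5 / 3 : ℝ)) * 2 ^ (j + 2) := by
    rw [hsq, show (1 + freqNormSq (modeAt j)) * (2 * (amp j ^ 2 * ‖pol (modeAt j)‖ ^ 2 / 8)) * I2 =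
      (1 + freqNormSq (modeAt j)) * 2 * (amp j ^ 2 * ‖pol (modeAt j)‖ ^ 2 / 8 * I2) by ring, amp_sq_mul hj]
    ring
  have hw := one_le_weight_mul_rpow (modeAt_ne_zero j)
  have hI := I2_pos
  have hle : (1 + freqNormSq (modeAt j)) * klen (modeAt j) ^ (-(5 / 3 : ℝ)) * 2 ^ (j + 2) ≤ C * I2 := by
    rw [← key]
    exact mul_le_mul_of_nonneg_right h hI.le
  have hpow : (2 : ℝ) ^ j₀ ≤ 2 ^ (j + 2) := pow_le_pow_right₀ (by norm_num) (by omega)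
  have hge : (2 : ℝ) ^ (j + 2) ≤ (1 + freqNormSq (modeAt j)) * klen (modeAt j) ^ (-(5 / 3 : ℝ)) * 2 ^ (j + 2) :=
    le_mul_of_one_le_left (by positivity) hw
  linarith

end K41Slot

/-! ## Kill -/
section KillsK41

open K41Slot

/-- **Refutes `Literature.Claims.NS.LiuYong2026.Step4_H1` [refuted-substantive, records-grade]** — Step 4
(引理H.1 p.57 L8–L17 as used in 命题4.4 p.18 L24–p.19 L4) at its LITERAL two-sided grain is false in the
print's forced class: the exact-K41 slot flow at `ν = 1` (smooth force on `[0,∞) × 𝕋³`, rest datum, exact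
classical hence global Leray–Hopf) has GENUINE Cesàro spectrum `Φ(k) = |k|^{−5/3}` for every `k ≠ 0`
(`IsK41` with `C = 1`, infrared bound `1`) and no uniform `H¹` bound. No cheap repair: restricting to the
print's `L^∞_t L²_x` layer makes the two-sided hypothesis unsatisfiable (`Σ_{ℤ³∖0}|k|^{−5/3} = ∞`), i.e. the
step vacuous there, while the used one-sided grain is false in that layer (`not_Step4_H1_upper_bdd`).
The adjudicated token of row #119 (`Step3_K41` / `not_Step3_K41`, p511629) is unchanged. -/
theorem not_Step4_H1 : ¬ Step4_H1 := fun h =>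
  not_uniformSobolevBounds_k41 (h 1 k41Frc (k41Vel 0) isData_k41 k41Vel PhiK isGlobalLerayHopf_k41
    hasCesaroSpectrum_k41 isK41_PhiK infraredBounded_PhiK)

/-- **Non-vacuity of Step 4's antecedent in the typed class**: some global Leray–Hopf solution of the
forced chain from Theorem-1 data has an exact two-sided K41 Cesàro spectrum, infrared bounded — and no
uniform Sobolev bounds. -/
theorem step4_H1_antecedent_witness :
    ∃ (ν : ℝ) (f : ℝ → T3 → E3) (u₀ : T3 → E3) (u : ℝ → T3 → E3) (Φ : Z3 → ℝ),
      IsData ν f u₀ ∧ Torus.IsGlobalLerayHopf ν f u₀ u ∧ HasCesaroSpectrum u Φ ∧ IsK41 Φ ∧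
        InfraredBounded Φ ∧ ¬ UniformSobolevBounds u :=
  ⟨1, k41Frc, k41Vel 0, k41Vel, PhiK, isData_k41, isGlobalLerayHopf_k41, hasCesaroSpectrum_k41,
    isK41_PhiK, infraredBounded_PhiK, not_uniformSobolevBounds_k41⟩

example : ¬ Literature.Claims.NS.LiuYong2026.Step4_H1 := not_Step4_H1

end KillsK41

end Summit.NavierStokesRegularity.NavierStokesRegularity.Theorems.LiuYong2026
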